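import Summits.AtomisticToContinuum.HydrodynamicLimit.Theses.LaxScheme
import HarnessLib

/-!
# Birth skeleton — crux `LaxScheme.PathwiseLaxBootstrap` (stmt-AtomisticToContinuum-18705; split child 1 of `LaxShadowing`)

BC3 of the strategist's decomposition (2026-08-17). Two named stubs and the composition `PathwiseLaxBootstrap_of`
(kernel-checked; sorries only inside the stubs):

* `stub_segmentBound` — the GRONWALL HALF: under integrability of `DIST`, the stability property on `δ₀`-closeness
  segments, the consistency property (allowance `η + L∫₀ˢDIST`) on `δ`-closeness segments and `C^M` data `≤ η`, on
  every `min δ δ₀`-closeness segment `[0,s]` the error is `≤ (C+1) η e^{CLt}` (monotonicity of `r ↦ ∫₀ʳ DIST`, `ciSup_le`,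
  integral Gronwall for a bounded integrable profile; no time-regularity used).
* `stub_continuousInduction` — the BOOTSTRAP HALF (pure real induction, no Gronwall): if the error is `≤ κ` on every
  `δ′`-closeness segment, the path has `(τ, j)`-oscillation, `κ + j ≤ δ′` and the error at time `0` is `≤ δ′`, then the
  error is `≤ κ` on all of `[0,t]` (the closeness segment advances in steps of `τ`).
* `PathwiseLaxBootstrap_of` — the composition: `κ := (C+1)ηe^{CLt}`, `δ′ := min δ δ₀`; the time-`0` closeness comes
  from the `C^M` datum with `l = []` (`D [] f = f`) and `η ≤ κ ≤ δ′ − j`.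
-/

noncomputable section

namespace Summit.AtomisticToContinuum.HydrodynamicLimit.Cruxes.PathwiseLaxBootstrap.Birth

open Set Filter Topology MeasureTheory

/-- STUB A (Gronwall half): the error bound on closeness segments. [cite: Strang1964] -/
theorem stub_segmentBound : ∀ lam : ℝ, ∀ σ : ℝ, ∀ (T : ℝ) (ρ θ : ℝ → UnitAddTorus (Fin 3) → ℝ) (u : ℝ → UnitAddTorus (Fin 3) → EuclideanSpace ℝ (Fin 3)), ∀ t : ℝ, 0 ≤ t → let k : UnitAddTorus (Fin 3) → ℝ := Literature.Analysis.FunctionSpaces.Torus.kernel lam; let VB := fun (r : ℝ) (x : UnitAddTorus (Fin 3)) => (∫ y, k (x - y) * ρ r y, ∫ y, (k (x - y) * ρ r y) • u r y, ∫ y, k (x - y) * Literature.MathematicalPhysics.KineticTheory.totalEnergyDensity (ρ r y) (u r y) (θ r y)); let P := fun (U : ℝ × EuclideanSpace ℝ (Fin 3) × ℝ) => Literature.MathematicalPhysics.KineticTheory.hsPressure σ U.1 (2 / 3 * (U.2.2 / U.1 - ‖U.2.1‖ ^ 2 / (2 * U.1 ^ 2))); let DIV := fun (W : UnitAddTorus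 (Fin 3) → ℝ × EuclideanSpace ℝ (Fin 3) × ℝ) (x : UnitAddTorus (Fin 3)) => (Literature.Analysis.FunctionSpaces.Torus.divergence (fun y => (W y).2.1) x, (∑ i : Fin 3, Literature.Analysis.FunctionSpaces.Torus.partialDeriv i (fun y => ((W y).2.1 i / (W y).1) • (W y).2.1) x) + Literature.Analysis.FunctionSpaces.Torus.gradient (fun y => P (W y)) x, Literature.Analysis.FunctionSpaces.Torus.divergence (fun y => (((W y).2.2 + P (W y)) / (W y).1) • (W y).2.1) x); let d := fun (V : ℝ → UnitAddTorus (Fin 3) → ℝ × EuclideanSpace ℝ (Fin 3) × ℝ) (r : ℝ) (x : UnitAddTorus (Fin 3)) => V r x - VB r x; let e := fun (V : ℝ → UnitAddTorus (Fin 3) → ℝ × EuclideanSpace ℝ (Fin 3) × ℝ) (s : ℝ) (x : UnitAddTorus (Fin 3)) => d V s x - d V 0 x + intervalIntegral (fun r => DIV (V r) x - DIV (VB r) x) 0 s MeasureTheory.volume; let D := fun (l : List (Fin 3)) (f : UnitAddTorus (Fin 3) → ℝ × EuclideanSpace ℝ (Fin 3) × ℝ) => List.foldr (fun (i : Fin 3)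 (g : UnitAddTorus (Fin 3) → ℝ × EuclideanSpace ℝ (Fin 3) × ℝ) => Literature.Analysis.FunctionSpaces.Torus.partialDeriv i g) f l; let DIST := fun (V : ℝ → UnitAddTorus (Fin 3) → ℝ × EuclideanSpace ℝ (Fin 3) × ℝ) (r : ℝ) => ⨆ x : UnitAddTorus (Fin 3), ‖d V r x‖; ∀ (V : ℝ → UnitAddTorus (Fin 3) → ℝ × EuclideanSpace ℝ (Fin 3) × ℝ) (M : ℕ) (δ δ₀ C L η : ℝ), 0 < δ → 0 < δ₀ → 0 ≤ C → 0 ≤ L → 0 ≤ η → MeasureTheory.IntegrableOn (fun r => DIST V r) (Set.Icc 0 t) MeasureTheory.volume → (∀ s ∈ Set.Icc 0 t, (∀ r ∈ Set.Icc 0 s, ∀ x, ‖d V r x‖ ≤ δ₀) → ∀ η' : ℝ, 0 ≤ η' → (∀ l : List (Fin 3), l.length ≤ M → ∀ x, ‖D l (d V 0) x‖ ≤ η') → (∀ r ∈ Set.Icc 0 s, ∀ l : List (Fin 3), l.length ≤ M → ∀ x, ‖D l (e V r) x‖ ≤ η') → ∀ r ∈ Set.Icc 0 s, ∀ x, ‖d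 V r x‖ ≤ C * η') → (∀ s ∈ Set.Icc 0 t, (∀ r ∈ Set.Icc 0 s, ∀ x, ‖d V r x‖ ≤ δ) → ∀ l : List (Fin 3), l.length ≤ M → ∀ x, ‖D l (e V s) x‖ ≤ η + L * intervalIntegral (fun r => DIST V r) 0 s MeasureTheory.volume) → (∀ l : List (Fin 3), l.length ≤ M → ∀ x, ‖D l (d V 0) x‖ ≤ η) → ∀ s ∈ Set.Icc 0 t, (∀ r ∈ Set.Icc 0 s, ∀ x, ‖d V r x‖ ≤ min δ δ₀) → ∀ r ∈ Set.Icc 0 s, ∀ x, ‖d V r x‖ ≤ (C + 1) * η * Real.exp (C * L * t) := by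
  sorry

/-- STUB B (bootstrap half): continuous induction in steps of `τ`. [cite: LaxRichtmyer1956] -/
theorem stub_continuousInduction : ∀ lam : ℝ, ∀ σ : ℝ, ∀ (T : ℝ) (ρ θ : ℝ → UnitAddTorus (Fin 3) → ℝ) (u : ℝ → UnitAddTorus (Fin 3) → EuclideanSpace ℝ (Fin 3)), ∀ t : ℝ, 0 ≤ t → let k : UnitAddTorus (Fin 3) → ℝ := Literature.Analysis.FunctionSpaces.Torus.kernel lam; let VB := fun (r : ℝ) (x : UnitAddTorus (Fin 3)) => (∫ y, k (x - y) * ρ r y, ∫ y, (k (x - y) * ρ r y) • u r y, ∫ y, k (x - y) * Literature.MathematicalPhysics.KineticTheory.totalEnergyDensity (ρ r y) (u r y) (θ r y)); let d := fun (V : ℝ → UnitAddTorus (Fin 3) → ℝ × EuclideanSpace ℝ (Fin 3) × ℝ) (r : ℝ) (x : UnitAddTorus (Fin 3)) => V r x - VB r x; ∀ (V : ℝ → UnitAddTorus (Fin 3) → ℝ × EuclideanSpace ℝ (Fin 3) × ℝ) (τ j κ δ' : ℝ), 0 < τ → 0 ≤ j → (∀ s ∈ Set.Icc 0 t, (∀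 r ∈ Set.Icc 0 s, ∀ x, ‖d V r x‖ ≤ δ') → ∀ r ∈ Set.Icc 0 s, ∀ x, ‖d V r x‖ ≤ κ) → (∀ r ∈ Set.Icc 0 t, ∀ r' ∈ Set.Icc 0 t, |r' - r| ≤ τ → ∀ x, ‖d V r' x - d V r x‖ ≤ j) → κ + j ≤ δ' → (∀ x, ‖d V 0 x‖ ≤ δ') → ∀ r ∈ Set.Icc 0 t, ∀ x, ‖d V r x‖ ≤ κ := by
  sorry

/-- **Composition**: the two stubs give the crux `PathwiseLaxBootstrap`. [cite: Strang1964] -/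
theorem PathwiseLaxBootstrap_of_subs : (∀ lam : ℝ, ∀ σ : ℝ, ∀ (T : ℝ) (ρ θ : ℝ → UnitAddTorus (Fin 3) → ℝ) (u : ℝ → UnitAddTorus (Fin 3) → EuclideanSpace ℝ (Fin 3)), ∀ t : ℝ, 0 ≤ t → let k : UnitAddTorus (Fin 3) → ℝ := Literature.Analysis.FunctionSpaces.Torus.kernel lam; let VB := fun (r : ℝ) (x : UnitAddTorus (Fin 3)) => (∫ y, k (x - y) * ρ r y, ∫ y, (k (x - y) * ρ r y) • u r y, ∫ y, k (x - y) * Literature.MathematicalPhysics.KineticTheory.totalEnergyDensity (ρ r y) (u r y) (θ r y)); let P := fun (U : ℝ × EuclideanSpace ℝ (Fin 3) × ℝ) => Literature.MathematicalPhysics.KineticTheory.hsPressure σ U.1 (2 / 3 * (U.2.2 / U.1 - ‖U.2.1‖ ^ 2 / (2 * U.1 ^ 2))); let DIV := fun (W : UnitAddTorus (Fin 3) → ℝ × EuclideanSpace ℝ (Fin 3) × ℝ) (x : UnitAddTorus (Fin 3)) => (Literature.Analysis.FunctionSpaces.Torus.divergence (fun y => (W y).2.1) x, (∑ i : Fin 3,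 Literature.Analysis.FunctionSpaces.Torus.partialDeriv i (fun y => ((W y).2.1 i / (W y).1) • (W y).2.1) x) + Literature.Analysis.FunctionSpaces.Torus.gradient (fun y => P (W y)) x, Literature.Analysis.FunctionSpaces.Torus.divergence (fun y => (((W y).2.2 + P (W y)) / (W y).1) • (W y).2.1) x); let d := fun (V : ℝ → UnitAddTorus (Fin 3) → ℝ × EuclideanSpace ℝ (Fin 3) × ℝ) (r : ℝ) (x : UnitAddTorus (Fin 3)) => V r x - VB r x; let e := fun (V : ℝ → UnitAddTorus (Fin 3) → ℝ × EuclideanSpace ℝ (Fin 3) × ℝ) (s : ℝ) (x : UnitAddTorus (Fin 3)) => d V s x - d V 0 x + intervalIntegral (fun r => DIV (V r) x - DIV (VB r) x) 0 s MeasureTheory.volume; let D := fun (l : List (Fin 3)) (f : UnitAddTorus (Fin 3) → ℝ × EuclideanSpace ℝ (Fin 3) × ℝ) => List.foldr (fun (i : Fin 3) (g : UnitAddTorus (Fin 3) → ℝ × EuclideanSpace ℝ (Fin 3) × ℝ) => Literature.Analysis.FunctionSpaces.Torus.partialDeriv i g) f l; let DIST := fun (V : ℝ → UnitAddTorus (Fin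 3) → ℝ × EuclideanSpace ℝ (Fin 3) × ℝ) (r : ℝ) => ⨆ x : UnitAddTorus (Fin 3), ‖d V r x‖; ∀ (V : ℝ → UnitAddTorus (Fin 3) → ℝ × EuclideanSpace ℝ (Fin 3) × ℝ) (M : ℕ) (δ δ₀ C L η : ℝ), 0 < δ → 0 < δ₀ → 0 ≤ C → 0 ≤ L → 0 ≤ η → MeasureTheory.IntegrableOn (fun r => DIST V r) (Set.Icc 0 t) MeasureTheory.volume → (∀ s ∈ Set.Icc 0 t, (∀ r ∈ Set.Icc 0 s, ∀ x, ‖d V r x‖ ≤ δ₀) → ∀ η' : ℝ, 0 ≤ η' → (∀ l : List (Fin 3), l.length ≤ M → ∀ x, ‖D l (d V 0) x‖ ≤ η') → (∀ r ∈ Set.Icc 0 s, ∀ l : List (Fin 3), l.length ≤ M → ∀ x, ‖D l (e V r) x‖ ≤ η') → ∀ r ∈ Set.Icc 0 s, ∀ x, ‖d V r x‖ ≤ C * η') → (∀ s ∈ Set.Icc 0 t, (∀ r ∈ Set.Icc 0 s, ∀ x, ‖d V r x‖ ≤ δ) → ∀ l : List (Fin 3), l.length ≤ M → ∀ x, ‖D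 l (e V s) x‖ ≤ η + L * intervalIntegral (fun r => DIST V r) 0 s MeasureTheory.volume) → (∀ l : List (Fin 3), l.length ≤ M → ∀ x, ‖D l (d V 0) x‖ ≤ η) → ∀ s ∈ Set.Icc 0 t, (∀ r ∈ Set.Icc 0 s, ∀ x, ‖d V r x‖ ≤ min δ δ₀) → ∀ r ∈ Set.Icc 0 s, ∀ x, ‖d V r x‖ ≤ (C + 1) * η * Real.exp (C * L * t)) → (∀ lam : ℝ, ∀ σ : ℝ, ∀ (T : ℝ) (ρ θ : ℝ → UnitAddTorus (Fin 3) → ℝ) (u : ℝ → UnitAddTorus (Fin 3) → EuclideanSpace ℝ (Fin 3)), ∀ t : ℝ, 0 ≤ t → let k : UnitAddTorus (Fin 3) → ℝ := Literature.Analysis.FunctionSpaces.Torus.kernel lam; let VB := fun (r : ℝ) (x : UnitAddTorus (Fin 3)) => (∫ y, k (x - y) * ρ r y, ∫ y, (k (x - y) * ρ r y) • u r y, ∫ y, k (x - y) * Literature.MathematicalPhysics.KineticTheory.totalEnergyDensity (ρ r y) (u r y) (θ r y)); let d := fun (V : ℝ → UnitAddTorus (Fin 3) → ℝ × EuclideanSpace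 ℝ (Fin 3) × ℝ) (r : ℝ) (x : UnitAddTorus (Fin 3)) => V r x - VB r x; ∀ (V : ℝ → UnitAddTorus (Fin 3) → ℝ × EuclideanSpace ℝ (Fin 3) × ℝ) (τ j κ δ' : ℝ), 0 < τ → 0 ≤ j → (∀ s ∈ Set.Icc 0 t, (∀ r ∈ Set.Icc 0 s, ∀ x, ‖d V r x‖ ≤ δ') → ∀ r ∈ Set.Icc 0 s, ∀ x, ‖d V r x‖ ≤ κ) → (∀ r ∈ Set.Icc 0 t, ∀ r' ∈ Set.Icc 0 t, |r' - r| ≤ τ → ∀ x, ‖d V r' x - d V r x‖ ≤ j) → κ + j ≤ δ' → (∀ x, ‖d V 0 x‖ ≤ δ') → ∀ r ∈ Set.Icc 0 t, ∀ x, ‖d V r x‖ ≤ κ) → (∀ lam : ℝ, ∀ σ : ℝ, ∀ (T : ℝ) (ρ θ : ℝ → UnitAddTorus (Fin 3) → ℝ) (u : ℝ → UnitAddTorus (Fin 3) → EuclideanSpace ℝ (Fin 3)), ∀ t : ℝ, 0 ≤ t → let k : UnitAddTorus (Fin 3) → ℝ := Literature.Analysis.FunctionSpaces.Torus.kernel lam;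 let VB := fun (r : ℝ) (x : UnitAddTorus (Fin 3)) => (∫ y, k (x - y) * ρ r y, ∫ y, (k (x - y) * ρ r y) • u r y, ∫ y, k (x - y) * Literature.MathematicalPhysics.KineticTheory.totalEnergyDensity (ρ r y) (u r y) (θ r y)); let P := fun (U : ℝ × EuclideanSpace ℝ (Fin 3) × ℝ) => Literature.MathematicalPhysics.KineticTheory.hsPressure σ U.1 (2 / 3 * (U.2.2 / U.1 - ‖U.2.1‖ ^ 2 / (2 * U.1 ^ 2))); let DIV := fun (W : UnitAddTorus (Fin 3) → ℝ × EuclideanSpace ℝ (Fin 3) × ℝ) (x : UnitAddTorus (Fin 3)) => (Literature.Analysis.FunctionSpaces.Torus.divergence (fun y => (W y).2.1) x, (∑ i : Fin 3, Literature.Analysis.FunctionSpaces.Torus.partialDeriv i (fun y => ((W y).2.1 i / (W y).1) • (W y).2.1) x) + Literature.Analysis.FunctionSpaces.Torus.gradient (fun y => P (W y)) x, Literature.Analysis.FunctionSpaces.Torus.divergence (fun y => (((W y).2.2 + P (W y)) / (W y).1) • (W y).2.1) x); let d := fun (V : ℝ → UnitAddTorus (Fin 3) → ℝ × EuclideanSpace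 ℝ (Fin 3) × ℝ) (r : ℝ) (x : UnitAddTorus (Fin 3)) => V r x - VB r x; let e := fun (V : ℝ → UnitAddTorus (Fin 3) → ℝ × EuclideanSpace ℝ (Fin 3) × ℝ) (s : ℝ) (x : UnitAddTorus (Fin 3)) => d V s x - d V 0 x + intervalIntegral (fun r => DIV (V r) x - DIV (VB r) x) 0 s MeasureTheory.volume; let D := fun (l : List (Fin 3)) (f : UnitAddTorus (Fin 3) → ℝ × EuclideanSpace ℝ (Fin 3) × ℝ) => List.foldr (fun (i : Fin 3) (g : UnitAddTorus (Fin 3) → ℝ × EuclideanSpace ℝ (Fin 3) × ℝ) => Literature.Analysis.FunctionSpaces.Torus.partialDeriv i g) f l; let DIST := fun (V : ℝ → UnitAddTorus (Fin 3) → ℝ × EuclideanSpace ℝ (Fin 3) × ℝ) (r : ℝ) => ⨆ x : UnitAddTorus (Fin 3), ‖d V r x‖; ∀ (V : ℝ → UnitAddTorus (Fin 3) → ℝ × EuclideanSpace ℝ (Fin 3) × ℝ) (M : ℕ) (δ δ₀ C L η j τ : ℝ), 0 < δ → 0 < δ₀ → 0 ≤ C → 0 ≤ L → 0 ≤ η →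 0 ≤ j → 0 < τ → MeasureTheory.IntegrableOn (fun r => DIST V r) (Set.Icc 0 t) MeasureTheory.volume → (∀ s ∈ Set.Icc 0 t, (∀ r ∈ Set.Icc 0 s, ∀ x, ‖d V r x‖ ≤ δ₀) → ∀ η' : ℝ, 0 ≤ η' → (∀ l : List (Fin 3), l.length ≤ M → ∀ x, ‖D l (d V 0) x‖ ≤ η') → (∀ r ∈ Set.Icc 0 s, ∀ l : List (Fin 3), l.length ≤ M → ∀ x, ‖D l (e V r) x‖ ≤ η') → ∀ r ∈ Set.Icc 0 s, ∀ x, ‖d V r x‖ ≤ C * η') → (∀ s ∈ Set.Icc 0 t, (∀ r ∈ Set.Icc 0 s, ∀ x, ‖d V r x‖ ≤ δ) → ∀ l : List (Fin 3), l.length ≤ M → ∀ x, ‖D l (e V s) x‖ ≤ η + L * intervalIntegral (fun r => DIST V r) 0 s MeasureTheory.volume) → (∀ l : List (Fin 3), l.length ≤ M → ∀ x, ‖D l (d V 0) x‖ ≤ η) → (∀ r ∈ Set.Icc 0 t, ∀ r' ∈ Set.Icc 0 t, |r' - r| ≤ τ → ∀ x, ‖d V r' x - d V r x‖ ≤ j)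 → (C + 1) * η * Real.exp (C * L * t) + j ≤ min δ δ₀ → ∀ r ∈ Set.Icc 0 t, ∀ x, ‖d V r x‖ ≤ (C + 1) * η * Real.exp (C * L * t)) := by
  intro hA hB
  intro lam σ T ρ θ u t ht
  have HA := hA lam σ T ρ θ u t ht
  have HB := hB lam σ T ρ θ u t ht
  dsimp only at HA HB ⊢
  intro V M δ δ₀ C L η j τ hδ hδ₀ hC hL hη hj hτ hInt Hstab Hcons Hinit Hreg hsmall
  have hseg := HA V M δ δ₀ C L η hδ hδ₀ hC hL hη hInt Hstab Hcons Hinit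
  -- `η ≤ κ := (C+1) η e^{CLt}`
  have hκ : η ≤ (C + 1) * η * Real.exp (C * L * t) := by
    have h1 : (1 : ℝ) ≤ (C + 1) * Real.exp (C * L * t) := by
      have he : (1 : ℝ) ≤ Real.exp (C * L * t) := Real.one_le_exp (by positivity)
      nlinarith
    nlinarith
  -- time-`0` closeness from the `C^M` datum with `l = []`
  have h0 : ∀ x, ‖V 0 x - (∫ y, Literature.Analysis.FunctionSpaces.Torus.kernel lam (x - y) * ρ 0 y,
      ∫ y, (Literature.Analysis.FunctionSpaces.Torus.kernel lam (x - y) * ρ 0 y) • u 0 y,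
      ∫ y, Literature.Analysis.FunctionSpaces.Torus.kernel lam (x - y) *
        Literature.MathematicalPhysics.KineticTheory.totalEnergyDensity (ρ 0 y) (u 0 y) (θ 0 y))‖ ≤ min δ δ₀ := by
    intro x
    have h := Hinit [] (by simp) x
    simp only [List.foldr_nil] at h
    linarith
  exact HB V τ j ((C + 1) * η * Real.exp (C * L * t)) (min δ δ₀) hτ hj hseg Hreg hsmall h0

/-- **The crux from the stubs.** [cite: Strang1964] -/
theorem PathwiseLaxBootstrap_of : Summit.AtomisticToContinuum.HydrodynamicLimit.Theses.LaxScheme.PathwiseLaxBootstrap :=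
  PathwiseLaxBootstrap_of_subs stub_segmentBound stub_continuousInduction

end Summit.AtomisticToContinuum.HydrodynamicLimit.Cruxes.PathwiseLaxBootstrap.Birth

end
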